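import Mathlib

/-!
# Freedman's inequality, exponential-supermartingale form

Stub `stub_freedman_exp` for line `klr-graded-polynomial-method` of crux
`stmt-MatrixMultiplication-8302`: for martingale differences `D (i+1)` (filtration `ℱ`,
`μ[D (i+1) | ℱ i] = 0`) bounded by `b`, with predictable quadratic variation
`V_n = Σ_{i<n} μ[D (i+1)² | ℱ i]`, and every `λ ≥ 0`,
`μ {x ≤ Σ_{i<n} D (i+1) ∧ V_n ≤ v} ≤ exp (−λx + v (e^{λb} − 1 − λb)/b²)`
[Freedman 1975, Thm 1.6, proof (4.1)–(4.3)].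

Proof: (1) the calculus bound `e^{λd} ≤ 1 + λd + d² ψ`, `ψ = (e^{λb} − 1 − λb)/b²`, for `|d| ≤ b`
(termwise comparison of the exponential series); (2) one supermartingale step
`∫ e^{Y − ψ μ[X²|m] + λX} ≤ ∫ e^Y` for an `m`-measurable exponent `Y` and a bounded increment `X`
with `μ[X|m] = 0` (pull-out property of the conditional expectation); (3) induction gives
`∫ exp (λ S_n − ψ V_n) ≤ 1`; (4) Markov's inequality. Mathlib's Azuma–Hoeffding
(`ProbabilityTheory.measure_sum_ge_le_of_hasCondSubgaussianMGF`) only covers deterministic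
sub-Gaussian constants; here the quadratic variation is random.
-/

open MeasureTheory ProbabilityTheory
open scoped BigOperators

namespace Summit.MatrixMultiplication.MatrixMultiplication.Theorems

/-- The tail of the exponential series: `Σ_{n ≥ 0} t^{n+2}/(n+2)! = e^t - 1 - t`. [folklore] -/
private theorem freedman_hasSum_exp_sub_one_sub (t : ℝ) :
    HasSum (fun n : ℕ => t ^ (n + 2) / ((n + 2).factorial : ℝ)) (Real.exp t - 1 - t) := by
  have h : HasSum (fun n : ℕ => t ^ n / (n.factorial : ℝ)) (Real.exp t) := by
    rw [Real.exp_eq_exp_ℝ]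
    exact NormedSpace.expSeries_div_hasSum_exp t
  have h2 := (hasSum_nat_add_iff' 2).mpr h
  simpa [Finset.sum_range_succ, sub_sub] using h2

/-- `e^t - 1 - t ≤ e^{|t|} - 1 - |t|` (termwise comparison of the tail series). [folklore] -/
private theorem freedman_exp_sub_le_abs (t : ℝ) :
    Real.exp t - 1 - t ≤ Real.exp |t| - 1 - |t| := by
  refine hasSum_le (fun n => ?_) (freedman_hasSum_exp_sub_one_sub t)
    (freedman_hasSum_exp_sub_one_sub |t|)
  have h : t ^ (n + 2) ≤ |t| ^ (n + 2) := by
    rw [← abs_pow]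
    exact le_abs_self _
  exact div_le_div_of_nonneg_right h (by positivity)

/-- For `0 ≤ λ` and `0 ≤ s ≤ b`: `b² (e^{λs} - 1 - λs) ≤ s² (e^{λb} - 1 - λb)`
(termwise comparison of the tail series). [folklore] -/
private theorem freedman_sq_mul_exp_sub_le {lam s b : ℝ} (hlam : 0 ≤ lam) (hs : 0 ≤ s)
    (hsb : s ≤ b) :
    b ^ 2 * (Real.exp (lam * s) - 1 - lam * s) ≤ s ^ 2 * (Real.exp (lam * b) - 1 - lam * b) := by
  have hb : 0 ≤ b := hs.trans hsb
  refine hasSum_le (fun n => ?_) ((freedman_hasSum_exp_sub_one_sub (lam * s)).mul_left (b ^ 2))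
    ((freedman_hasSum_exp_sub_one_sub (lam * b)).mul_left (s ^ 2))
  have key : b ^ 2 * ((lam * s) ^ (n + 2) / ((n + 2).factorial : ℝ)) =
      (lam ^ (n + 2) * b ^ 2 * s ^ 2 / ((n + 2).factorial : ℝ)) * s ^ n := by ring
  have key' : s ^ 2 * ((lam * b) ^ (n + 2) / ((n + 2).factorial : ℝ)) =
      (lam ^ (n + 2) * b ^ 2 * s ^ 2 / ((n + 2).factorial : ℝ)) * b ^ n := by ring
  rw [key, key']
  exact mul_le_mul_of_nonneg_left (pow_le_pow_left₀ hs hsb n) (by positivity)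

/-- **The calculus input** (Freedman 1975, (4.1); Bennett 1962): for `|d| ≤ b`, `0 < b`, `0 ≤ λ`,
`e^{λd} ≤ 1 + λd + d² (e^{λb} - 1 - λb)/b²` (`e^t - 1 - t ≤ e^{|t|} - 1 - |t|` and
`b² (e^{λs} - 1 - λs) ≤ s² (e^{λb} - 1 - λb)` for `0 ≤ s ≤ b`, both termwise). [folklore] -/
private theorem freedman_exp_le_quad {b lam d : ℝ} (hb : 0 < b) (hlam : 0 ≤ lam) (hd : |d| ≤ b) :
    Real.exp (lam * d) ≤
      1 + lam * d + d ^ 2 * ((Real.exp (lam * b) - 1 - lam * b) / b ^ 2) := by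
  have h1 := freedman_exp_sub_le_abs (lam * d)
  rw [abs_mul, abs_of_nonneg hlam] at h1
  have h2 := freedman_sq_mul_exp_sub_le hlam (abs_nonneg d) hd
  rw [sq_abs] at h2
  have hb2 : 0 < b ^ 2 := by positivity
  have h3 : Real.exp (lam * |d|) - 1 - lam * |d| ≤
      d ^ 2 * ((Real.exp (lam * b) - 1 - lam * b) / b ^ 2) := by
    rw [mul_div_assoc', le_div_iff₀ hb2]
    linarith
  linarith


/-- **One Freedman step.** Let `m ≤ mΩ` be a sub-σ-algebra of a finite measure space, `Y` an
`m`-measurable real function with `e^Y` integrable, and `X` a bounded increment (`|X| ≤ b`) with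
`μ[X | m] = 0` a.e., satisfying the pointwise bound `e^{λX} ≤ 1 + λX + ψX²` with `ψ ≥ 0`. Then
`e^{Y - ψ μ[X² | m] + λX}` is integrable and `∫ e^{Y - ψ μ[X² | m] + λX} dμ ≤ ∫ e^Y dμ`: multiply
the pointwise bound by the `m`-measurable weight `G = e^{Y - ψ μ[X²|m]}`, integrate, pull `G` out
of the conditional expectations (`∫ G X = ∫ G μ[X|m] = 0`, `∫ G X² = ∫ G μ[X²|m]`), and use
`1 + u ≤ e^u`. [folklore] -/
private theorem freedman_step {Ω : Type*} {m mΩ : MeasurableSpace Ω} {μ : Measure Ω}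
    [IsFiniteMeasure μ] (hm : m ≤ mΩ) {Y X : Ω → ℝ} {b lam ψ : ℝ}
    (hY : StronglyMeasurable[m] Y) (hYint : Integrable (fun ω => Real.exp (Y ω)) μ)
    (hX : AEStronglyMeasurable X μ) (hXbdd : ∀ ω, |X ω| ≤ b) (hX0 : μ[X | m] =ᵐ[μ] 0)
    (hψ : 0 ≤ ψ) (hquad : ∀ ω, Real.exp (lam * X ω) ≤ 1 + lam * X ω + ψ * X ω ^ 2) :
    Integrable (fun ω => Real.exp (Y ω - ψ * (μ[fun ω' => X ω' ^ 2 | m]) ω + lam * X ω)) μ ∧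
      ∫ ω, Real.exp (Y ω - ψ * (μ[fun ω' => X ω' ^ 2 | m]) ω + lam * X ω) ∂μ ≤
        ∫ ω, Real.exp (Y ω) ∂μ := by
  set V : Ω → ℝ := μ[fun ω' => X ω' ^ 2 | m] with hVdef
  set G : Ω → ℝ := fun ω => Real.exp (Y ω - ψ * V ω) with hGdef
  -- integrability of the bounded increment and its square
  have hXint : Integrable X μ :=
    Integrable.of_bound hX b (ae_of_all _ fun ω => by rw [Real.norm_eq_abs]; exact hXbdd ω)
  have hX2m : AEStronglyMeasurable (fun ω => X ω ^ 2) μ := hX.pow 2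
  have hX2int : Integrable (fun ω => X ω ^ 2) μ :=
    Integrable.of_bound hX2m (b ^ 2) (ae_of_all _ fun ω => by
      rw [Real.norm_eq_abs, abs_pow]
      exact pow_le_pow_left₀ (abs_nonneg _) (hXbdd ω) 2)
  -- the weight `G` is `m`-measurable, positive and dominated by `e^Y`
  have hVm : StronglyMeasurable[m] V := stronglyMeasurable_condExp
  have hV0 : 0 ≤ᵐ[μ] V := condExp_nonneg (ae_of_all _ fun ω => sq_nonneg (X ω))
  have hGm : StronglyMeasurable[m] G :=
    Real.continuous_exp.comp_stronglyMeasurable (hY.sub (hVm.const_mul ψ))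
  have hGint : Integrable G μ := by
    refine hYint.mono' (hGm.mono hm).aestronglyMeasurable ?_
    filter_upwards [hV0] with ω hω
    rw [Real.norm_eq_abs, Real.abs_exp]
    exact Real.exp_le_exp.mpr (sub_le_self _ (mul_nonneg hψ hω))
  have hGX : Integrable (fun ω => G ω * X ω) μ :=
    hGint.mul_bdd hX (ae_of_all _ fun ω => by rw [Real.norm_eq_abs]; exact hXbdd ω)
  have hGX2 : Integrable (fun ω => G ω * X ω ^ 2) μ :=
    hGint.mul_bdd hX2m (ae_of_all _ fun ω => by
      rw [Real.norm_eq_abs, abs_pow]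
      exact pow_le_pow_left₀ (abs_nonneg _) (hXbdd ω) 2)
  -- pull-out: the linear term integrates to zero
  have hGX0 : ∫ ω, G ω * X ω ∂μ = 0 := by
    have hpull : μ[G * X | m] =ᵐ[μ] G * μ[X | m] :=
      condExp_mul_of_stronglyMeasurable_left hGm hGX hXint
    calc ∫ ω, G ω * X ω ∂μ = ∫ ω, (μ[G * X | m]) ω ∂μ := (integral_condExp hm).symm
      _ = ∫ ω, G ω * (μ[X | m]) ω ∂μ := by
          refine integral_congr_ae ?_
          filter_upwards [hpull] with ω hω
          simpa only [Pi.mul_apply] using hω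
      _ = 0 := by
          rw [← integral_zero Ω ℝ]
          refine integral_congr_ae ?_
          filter_upwards [hX0] with ω hω
          simp [hω]
  -- pull-out: the quadratic term becomes the conditional variance
  have hpull2 : μ[G * fun ω' => X ω' ^ 2 | m] =ᵐ[μ] G * V :=
    condExp_mul_of_stronglyMeasurable_left hGm hGX2 hX2int
  have hGVint : Integrable (fun ω => G ω * V ω) μ :=
    (integrable_condExp.congr hpull2 : Integrable (G * V) μ)
  have hGX2eq : ∫ ω, G ω * X ω ^ 2 ∂μ = ∫ ω, G ω * V ω ∂μ := by
    calc ∫ ω, G ω * X ω ^ 2 ∂μ = ∫ ω, (μ[G * fun ω' => X ω' ^ 2 | m]) ω ∂μ :=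
          (integral_condExp hm).symm
      _ = ∫ ω, G ω * V ω ∂μ := by
          refine integral_congr_ae ?_
          filter_upwards [hpull2] with ω hω
          simpa only [Pi.mul_apply] using hω
  -- the pointwise bound, multiplied by the positive weight `G`
  have hpt : ∀ ω, Real.exp (Y ω - ψ * V ω + lam * X ω) ≤
      G ω + lam * (G ω * X ω) + ψ * (G ω * X ω ^ 2) := by
    intro ω
    rw [Real.exp_add]
    calc Real.exp (Y ω - ψ * V ω) * Real.exp (lam * X ω)
        ≤ Real.exp (Y ω - ψ * V ω) * (1 + lam * X ω + ψ * X ω ^ 2) :=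
          mul_le_mul_of_nonneg_left (hquad ω) (Real.exp_pos _).le
      _ = G ω + lam * (G ω * X ω) + ψ * (G ω * X ω ^ 2) := by rw [hGdef]; ring
  have hlin : Integrable (fun ω => G ω + lam * (G ω * X ω)) μ :=
    hGint.add (hGX.const_mul lam)
  have hrhs : Integrable (fun ω => G ω + lam * (G ω * X ω) + ψ * (G ω * X ω ^ 2)) μ :=
    hlin.add (hGX2.const_mul ψ)
  have hFm : AEStronglyMeasurable (fun ω => Real.exp (Y ω - ψ * V ω + lam * X ω)) μ :=
    Real.continuous_exp.comp_aestronglyMeasurable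
      (((hY.mono hm).sub ((hVm.mono hm).const_mul ψ)).aestronglyMeasurable.add
        (hX.const_mul lam))
  have hFint : Integrable (fun ω => Real.exp (Y ω - ψ * V ω + lam * X ω)) μ :=
    hrhs.mono' hFm (ae_of_all _ fun ω => by
      rw [Real.norm_eq_abs, Real.abs_exp]
      exact hpt ω)
  refine ⟨hFint, ?_⟩
  calc ∫ ω, Real.exp (Y ω - ψ * V ω + lam * X ω) ∂μ
      ≤ ∫ ω, (G ω + lam * (G ω * X ω) + ψ * (G ω * X ω ^ 2)) ∂μ :=
        integral_mono hFint hrhs hpt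
    _ = ∫ ω, G ω ∂μ + lam * ∫ ω, G ω * X ω ∂μ + ψ * ∫ ω, G ω * X ω ^ 2 ∂μ := by
        rw [integral_add hlin (hGX2.const_mul ψ), integral_add hGint (hGX.const_mul lam),
          integral_const_mul, integral_const_mul]
    _ = ∫ ω, (G ω + ψ * (G ω * V ω)) ∂μ := by
        rw [hGX0, mul_zero, add_zero, hGX2eq, integral_add hGint (hGVint.const_mul ψ),
          integral_const_mul]
    _ ≤ ∫ ω, Real.exp (Y ω) ∂μ := by
        refine integral_mono (hGint.add (hGVint.const_mul ψ)) hYint fun ω => ?_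
        calc G ω + ψ * (G ω * V ω) = G ω * (ψ * V ω + 1) := by ring
          _ ≤ G ω * Real.exp (ψ * V ω) :=
              mul_le_mul_of_nonneg_left (Real.add_one_le_exp _) (Real.exp_pos _).le
          _ = Real.exp (Y ω) := by
              rw [hGdef, ← Real.exp_add]
              ring_nf

/-- **The exponential supermartingale.** With `S_k = Σ_{i<k} D (i+1)`,
`V_k = Σ_{i<k} μ[D (i+1)² | ℱ i]` and `ψ ≥ 0` such that `e^{λ D i} ≤ 1 + λ D i + ψ (D i)²`
pointwise, `Z_k = exp (λ S_k − ψ V_k)` is integrable with `∫ Z_k dμ ≤ 1` for every `k`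
(induction on `k` with `freedman_step`; `Z_0 = 1`). [folklore] -/
private theorem freedman_integral_exp_le_one {Ω : Type*} {mΩ : MeasurableSpace Ω} {μ : Measure Ω}
    [IsProbabilityMeasure μ] (ℱ : Filtration ℕ mΩ) (D : ℕ → Ω → ℝ) (b : ℝ)
    (h_meas : ∀ i, StronglyMeasurable[ℱ i] (D i)) (h_bdd : ∀ i ω, |D i ω| ≤ b)
    (h_mds : ∀ i, μ[D (i + 1) | ℱ i] =ᵐ[μ] 0) {lam ψ : ℝ} (hψ : 0 ≤ ψ)
    (hquad : ∀ i ω, Real.exp (lam * D i ω) ≤ 1 + lam * D i ω + ψ * D i ω ^ 2) (k : ℕ) :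
    Integrable (fun ω => Real.exp (lam * ∑ i ∈ Finset.range k, D (i + 1) ω -
        ψ * ∑ i ∈ Finset.range k, (μ[fun ω' => D (i + 1) ω' ^ 2 | ℱ i]) ω)) μ ∧
      ∫ ω, Real.exp (lam * ∑ i ∈ Finset.range k, D (i + 1) ω -
        ψ * ∑ i ∈ Finset.range k, (μ[fun ω' => D (i + 1) ω' ^ 2 | ℱ i]) ω) ∂μ ≤ 1 := by
  induction k with
  | zero =>
    simp only [Finset.range_zero, Finset.sum_empty, mul_zero, sub_zero, Real.exp_zero]
    exact ⟨integrable_const 1, by simp⟩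
  | succ k ih =>
    -- the exponent at time `k` is `ℱ k`-measurable
    have hSm : StronglyMeasurable[ℱ k] (fun ω => ∑ i ∈ Finset.range k, D (i + 1) ω) :=
      Finset.stronglyMeasurable_fun_sum (Finset.range k) fun i hi =>
        (h_meas (i + 1)).mono (ℱ.mono (Nat.succ_le_of_lt (Finset.mem_range.mp hi)))
    have hVm : StronglyMeasurable[ℱ k]
        (fun ω => ∑ i ∈ Finset.range k, (μ[fun ω' => D (i + 1) ω' ^ 2 | ℱ i]) ω) :=
      Finset.stronglyMeasurable_fun_sum (Finset.range k) fun i hi =>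
        stronglyMeasurable_condExp.mono (ℱ.mono (Finset.mem_range.mp hi).le)
    have hY : StronglyMeasurable[ℱ k] (fun ω => lam * ∑ i ∈ Finset.range k, D (i + 1) ω -
        ψ * ∑ i ∈ Finset.range k, (μ[fun ω' => D (i + 1) ω' ^ 2 | ℱ i]) ω) :=
      (hSm.const_mul lam).sub (hVm.const_mul ψ)
    have hstep := freedman_step (ℱ.le k) hY ih.1
      ((h_meas (k + 1)).mono (ℱ.le (k + 1))).aestronglyMeasurable (h_bdd (k + 1)) (h_mds k)
      hψ (hquad (k + 1))
    have hrw : (fun ω => Real.exp (lam * ∑ i ∈ Finset.range (k + 1), D (i + 1) ω -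
        ψ * ∑ i ∈ Finset.range (k + 1), (μ[fun ω' => D (i + 1) ω' ^ 2 | ℱ i]) ω)) =
        fun ω => Real.exp (lam * ∑ i ∈ Finset.range k, D (i + 1) ω -
          ψ * ∑ i ∈ Finset.range k, (μ[fun ω' => D (i + 1) ω' ^ 2 | ℱ i]) ω -
          ψ * (μ[fun ω' => D (k + 1) ω' ^ 2 | ℱ k]) ω + lam * D (k + 1) ω) := by
      funext ω
      simp only [Finset.sum_range_succ]
      ring_nf
    rw [hrw]
    exact ⟨hstep.1, hstep.2.trans ih.2⟩

set_option linter.dupNamespace false in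
/-- **Freedman's inequality (exponential-supermartingale form).** Let `D 1, D 2, …` be martingale
differences for the filtration `ℱ` (`D (i+1)` is `ℱ (i+1)`-measurable with `μ[D (i+1) | ℱ i] = 0`
a.e.), bounded by `b > 0`.  With the predictable quadratic variation
`V_n = Σ_{i<n} μ[D (i+1)² | ℱ i]`, for every `λ ≥ 0`, `x`, `v`:
`μ {x ≤ Σ_{i<n} D (i+1) ∧ V_n ≤ v} ≤ exp(−λx + v·(e^{λb} − 1 − λb)/b²)`.
(Optimising `λ` gives Freedman's `exp(−x²/(2(v + bx)))` and Bernstein's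
`exp(−x²/(2(v + bx/3)))`.)
Proof: `Z_n = exp (λ S_n − ψ V_n)` has `∫ Z_n ≤ 1` (`freedman_integral_exp_le_one`), the event is
contained in `{exp (λx − ψv) ≤ Z_n}`, and Markov's inequality concludes.
[Freedman 1975, Thm. 1.6; proof (4.1)–(4.3)] -/
theorem stub_freedman_exp {Ω : Type*} {mΩ : MeasurableSpace Ω} {μ : Measure Ω} [IsProbabilityMeasure μ]
    (ℱ : Filtration ℕ mΩ) (D : ℕ → Ω → ℝ) (b : ℝ) (hb : 0 < b)
    (h_meas : ∀ i, StronglyMeasurable[ℱ i] (D i))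
    (h_bdd : ∀ i ω, |D i ω| ≤ b)
    (h_mds : ∀ i, μ[D (i + 1) | ℱ i] =ᵐ[μ] 0)
    (n : ℕ) (x v lam : ℝ) (hlam : 0 ≤ lam) :
    μ.real {ω | x ≤ ∑ i ∈ Finset.range n, D (i + 1) ω ∧
        ∑ i ∈ Finset.range n, (μ[fun ω' => D (i + 1) ω' ^ 2 | ℱ i]) ω ≤ v} ≤
      Real.exp (-(lam * x) + v * ((Real.exp (lam * b) - 1 - lam * b) / b ^ 2)) := by
  set ψ : ℝ := (Real.exp (lam * b) - 1 - lam * b) / b ^ 2 with hψdef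
  have hψ : 0 ≤ ψ := div_nonneg (by linarith [Real.add_one_le_exp (lam * b)]) (sq_nonneg b)
  have hquad : ∀ i ω, Real.exp (lam * D i ω) ≤ 1 + lam * D i ω + ψ * D i ω ^ 2 := by
    intro i ω
    have h := freedman_exp_le_quad hb hlam (h_bdd i ω)
    rw [← hψdef] at h
    linarith [mul_comm ψ (D i ω ^ 2)]
  obtain ⟨hZint, hZle⟩ :=
    freedman_integral_exp_le_one ℱ D b h_meas h_bdd h_mds hψ hquad n
  set ε : ℝ := Real.exp (lam * x - ψ * v) with hεdef
  have hε : 0 < ε := Real.exp_pos _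
  have hsub : {ω | x ≤ ∑ i ∈ Finset.range n, D (i + 1) ω ∧
      ∑ i ∈ Finset.range n, (μ[fun ω' => D (i + 1) ω' ^ 2 | ℱ i]) ω ≤ v} ⊆
      {ω | ε ≤ Real.exp (lam * ∑ i ∈ Finset.range n, D (i + 1) ω -
        ψ * ∑ i ∈ Finset.range n, (μ[fun ω' => D (i + 1) ω' ^ 2 | ℱ i]) ω)} := by
    rintro ω ⟨h1, h2⟩
    refine Real.exp_le_exp.mpr ?_
    have h1' := mul_le_mul_of_nonneg_left h1 hlam
    have h2' := mul_le_mul_of_nonneg_left h2 hψ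
    linarith
  have hmarkov :=
    mul_meas_ge_le_integral_of_nonneg (ae_of_all _ fun ω => (Real.exp_pos _).le) hZint ε
  calc μ.real {ω | x ≤ ∑ i ∈ Finset.range n, D (i + 1) ω ∧
        ∑ i ∈ Finset.range n, (μ[fun ω' => D (i + 1) ω' ^ 2 | ℱ i]) ω ≤ v}
      ≤ μ.real {ω | ε ≤ Real.exp (lam * ∑ i ∈ Finset.range n, D (i + 1) ω -
          ψ * ∑ i ∈ Finset.range n, (μ[fun ω' => D (i + 1) ω' ^ 2 | ℱ i]) ω)} :=
        measureReal_mono hsub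
    _ ≤ (∫ ω, Real.exp (lam * ∑ i ∈ Finset.range n, D (i + 1) ω -
          ψ * ∑ i ∈ Finset.range n, (μ[fun ω' => D (i + 1) ω' ^ 2 | ℱ i]) ω) ∂μ) / ε := by
        rw [le_div_iff₀ hε, mul_comm]
        exact hmarkov
    _ ≤ 1 / ε := div_le_div_of_nonneg_right hZle hε.le
    _ = Real.exp (-(lam * x) + v * ψ) := by
        rw [hεdef, one_div, ← Real.exp_neg]
        congr 1
        ring

end Summit.MatrixMultiplication.MatrixMultiplication.Theorems
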